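import Literature.AlgebraicGeometry.Resolution.AbhyankarEtaleAscentProofs
import Literature.AlgebraicGeometry.Resolution.KnafKuhlmann2005Thm34HenselRoot
import Literature.AlgebraicGeometry.Resolution.AbhyankarRationalUniformization
import Literature.AlgebraicGeometry.Resolution.KnafKuhlmann2009Prop23
import Literature.AlgebraicGeometry.Resolution.ValuedFunctionFieldsLemmas
import Summits.ResolutionOfSingularities.ResolutionOfSingularities.Theorems.ValuativeLuAlphaPTorsorHenselRootChart
import Summits.ResolutionOfSingularities.ResolutionOfSingularities.Theorems.ValuativeLuAlphaPTorsorAdaptedDefs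
import Summits.ResolutionOfSingularities.ResolutionOfSingularities.Theorems.ValuativeLuAlphaPTorsorAdaptedHenselRootChartHelpers
import Mathlib.FieldTheory.Minpoly.IsIntegrallyClosed
import Mathlib.RingTheory.Polynomial.UniqueFactorization
import Mathlib.RingTheory.Polynomial.RationalRoot
import Mathlib.RingTheory.Polynomial.ScaleRoots
import HarnessLib

/-!
# Adapted Hensel-root charts: the level engine

Crux `Valuative.LuAlphaPTorsor` (item `stmt-ResolutionOfSingularities-0641`), line
`pfaff-line-log-final-forms`, registered stub `stub_adaptedHenselRootChart` (F3, reshape v6.3);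
registered helper sub-goal `adHensel_prod_valuation_zpow_add`.

`adHensel_level` is S2's centre computation (`span_eq_centre` of `…HenselRootChartHelpers`)
run at a level `ℓ` of the value lattice, i.e. for the coarsening of `O` in which the parameters
of level `< ℓ` become units: for `x₁, …, xₙ ∈ 𝔪_O ∖ 0` with `ℤ`-independent values, the
variables of level `≥ ℓ` smaller than all Laurent monomials of level `< ℓ`, and `η ∈ O` a root of
a monic `F ∈ k[X][T]` whose reduction `F(0; T)` has the residue `η̄` as a SIMPLE root, the set
`𝔭 = {g ∈ k[X_{<ℓ}][T] : v(g(x; η)) < v(x^m) for all m of level < ℓ}` is a prime ideal lying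
over `0` (Gauss form of `v` on `k[x_{<ℓ}]`, `adHensel_exists_dominant`) containing the monic
`F(X_{<ℓ}, 0; T)`, hence (`adHensel_exists_monic_generator`) `𝔭 = (m)` with
`F(X_{<ℓ}, 0; T) = m c`; reducing to `k[T]`, `η̄` is a root of `m̄` and a simple root of
`F(0; T) = m̄ c̄`, so `c̄(η̄) ≠ 0`: the cofactor value `a = c(x; η)` is an `O`-unit, and every
`G ∈ k[X][T]` with `G(x_{<ℓ}, 0; η) ∈ 𝔭`-small satisfies `G(x_{<ℓ}, 0; η) a = F(x_{<ℓ}, 0; η) w`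
with `w ∈ k[x, η]`.
-/

-- single-problem summit: the doubled namespace component `ResolutionOfSingularities` is forced
set_option linter.dupNamespace false

namespace Summit.ResolutionOfSingularities.ResolutionOfSingularities.Theorems.PfaffLine

open IsLocalRing Polynomial Literature.AlgebraicGeometry.Resolution

/-! ### Laurent monomials of values -/

/-- **Registered anchor.** `v(x^{m+m'}) = v(x^m) v(x^{m'})`. [folklore] -/
theorem adHensel_prod_valuation_zpow_add :
    ∀ (K : Type) [Field K] (O : ValuationSubring K) (n : ℕ) (x : Fin n → K), (∀ i, x i ≠ 0) → ∀ m m' : Fin n → ℤ, (∏ j, O.valuation (x j) ^ ((m + m') j)) = (∏ j, O.valuation (x j) ^ (m j)) * ∏ j, O.valuation (x j) ^ (m' j) := by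
  intro K _ O n x hx0 m m'
  rw [← Finset.prod_mul_distrib]
  exact Finset.prod_congr rfl fun j _ => by
    rw [Pi.add_apply, zpow_add₀ ((map_ne_zero O.valuation).mpr (hx0 j))]

/-! ### The level engine: the minimal polynomial of `η` modulo the variables of level `≥ ℓ` -/

/-- **Level `ℓ` cofactor.** Let `x₁, …, xₙ ∈ 𝔪_O ∖ 0` have `ℤ`-independent values, let the
variables of level `≥ ℓ` be smaller than every Laurent monomial of level `< ℓ`, and let `η ∈ O`
be a root of `F(x; T)`, `F ∈ k[X][T]` monic, whose reduction `F(0; T) ∈ k[T]` has `η̄` as a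
SIMPLE root in the residue field. Then there is an `O`-unit `a = c(x; η) ∈ k[x, η]` such that for
every `G ∈ k[X][T]` whose value `G(x_{<ℓ}, 0; η)` is smaller than every Laurent monomial of level
`< ℓ` one has `G(x_{<ℓ}, 0; η) · a = F(x_{<ℓ}, 0; η) · w` for some `w ∈ k[x, η]`. (The prime
`{g ∈ k[X_{<ℓ}][T] : g(x; η) small}` lies over `0` by the Gauss form of `v` on `k[x_{<ℓ}]`, and
contains the monic `F(X_{<ℓ}, 0; T)`; by `adHensel_exists_monic_generator` it is generated by a
monic `m` with `F(X_{<ℓ}, 0; T) = m c`; reducing to `k[T]`, `η̄` is a root of `m̄` and a simple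
root of `m̄ c̄`, so `c̄(η̄) ≠ 0`, i.e. `c(x; η)` is a unit.) [folklore] -/
theorem adHensel_level {k K : Type} [Field k] [Field K] [Algebra k K] (O : ValuationSubring K)
    (hk : ∀ c : k, algebraMap k K c ∈ O) {n : ℕ} (x : Fin n → K) (hx0 : ∀ i, x i ≠ 0)
    (hvx : ∀ i, O.valuation (x i) < 1)
    (hxi : ∀ m : Fin n → ℤ, (∏ i, O.valuation (x i) ^ (m i)) = 1 → m = 0)
    (lv : Fin n → ℕ) (ℓ : ℕ)
    (hhi : ∀ i, ℓ ≤ lv i → ∀ m : Fin n → ℤ, (∀ j, ℓ ≤ lv j → m j = 0) →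
      O.valuation (x i) < ∏ j, O.valuation (x j) ^ (m j))
    {η : K} (hη : η ∈ O) (F : (MvPolynomial (Fin n) k)[X]) (hFm : F.Monic)
    (hF0 : F.eval₂ (MvPolynomial.aeval x).toRingHom η = 0)
    (hfb1 : O.valuation (aeval η (derivative (F.map MvPolynomial.constantCoeff))) = 1) :
    ∃ a ∈ Algebra.adjoin k (Set.range x ∪ {η}), O.valuation a = 1 ∧
      ∀ G : (MvPolynomial (Fin n) k)[X],
        (∀ m : Fin n → ℤ, (∀ j, ℓ ≤ lv j → m j = 0) →
          O.valuation (G.eval₂ (MvPolynomial.aeval fun i => if lv i < ℓ then x i else 0).toRingHom η) <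
            ∏ j, O.valuation (x j) ^ (m j)) →
        ∃ w ∈ Algebra.adjoin k (Set.range x ∪ {η}),
          G.eval₂ (MvPolynomial.aeval fun i => if lv i < ℓ then x i else 0).toRingHom η * a =
            F.eval₂ (MvPolynomial.aeval fun i => if lv i < ℓ then x i else 0).toRingHom η * w := by
  classical
  set xlo : Fin n → K := fun i => if lv i < ℓ then x i else 0 with hxlo
  have hxO : ∀ i, x i ∈ O := fun i => (O.valuation_le_one_iff _).mp (hvx i).le
  have hv0 : ∀ j, O.valuation (x j) ≠ 0 := fun j => (map_ne_zero O.valuation).mpr (hx0 j)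
  have hprod0 : ∀ m : Fin n → ℤ, (∏ j, O.valuation (x j) ^ (m j)) ≠ 0 := fun m =>
    Finset.prod_ne_zero_iff.mpr fun j _ => zpow_ne_zero _ (hv0 j)
  -- the low variables `x ∘ val`, their polynomial ring `S = k[X_{<ℓ}]` and `π : k[X] → S`
  set φ : MvPolynomial {i : Fin n // lv i < ℓ} k →ₐ[k] K :=
    MvPolynomial.aeval fun i => x i.1 with hφdef
  set π : MvPolynomial (Fin n) k →ₐ[k] MvPolynomial {i : Fin n // lv i < ℓ} k :=
    MvPolynomial.aeval fun i => if h : lv i < ℓ then MvPolynomial.X ⟨i, h⟩ else 0 with hπdef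
  have hφπ : φ.comp π = MvPolynomial.aeval xlo := by
    refine MvPolynomial.algHom_ext fun i => ?_
    rw [AlgHom.comp_apply, hπdef, MvPolynomial.aeval_X, MvPolynomial.aeval_X, hxlo]
    by_cases h : lv i < ℓ
    · rw [dif_pos h, hφdef, MvPolynomial.aeval_X]
      dsimp only
      rw [if_pos h]
    · rw [dif_neg h, map_zero]
      dsimp only
      rw [if_neg h]
  have hcomp : φ.toRingHom.comp π.toRingHom = (MvPolynomial.aeval xlo).toRingHom := by
    rw [← hφπ]
    rfl
  have hev : ∀ G : (MvPolynomial (Fin n) k)[X],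
      (G.map π.toRingHom).eval₂ φ.toRingHom η = G.eval₂ (MvPolynomial.aeval xlo).toRingHom η := by
    intro G
    rw [eval₂_map, hcomp]
  -- `small z`: `v z` is below every Laurent monomial of level `< ℓ`
  let small : K → Prop := fun z => ∀ m : Fin n → ℤ, (∀ j, ℓ ≤ lv j → m j = 0) →
    O.valuation z < ∏ j, O.valuation (x j) ^ (m j)
  have hs0 : small 0 := fun m _ => by
    rw [map_zero]
    exact zero_lt_iff.mpr (hprod0 m)
  have hsadd : ∀ a b, small a → small b → small (a + b) := fun a b ha hb m hm =>
    Valuation.map_add_lt _ (ha m hm) (hb m hm)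
  have hsmulO : ∀ a b, a ∈ O → small b → small (a * b) := fun a b ha hb m hm => by
    rw [map_mul]
    exact mul_lt_of_le_one_of_lt ((O.valuation_le_one_iff _).mpr ha) (hb m hm)
  have hsprime : ∀ a b, small (a * b) → small a ∨ small b := by
    intro a b hab
    by_contra h
    rw [not_or] at h
    obtain ⟨h1, h2⟩ := h
    simp only [small, not_forall, not_lt, exists_prop] at h1 h2
    obtain ⟨m₁, hm₁, h1⟩ := h1
    obtain ⟨m₂, hm₂, h2⟩ := h2
    have h3 := hab (m₁ + m₂) (fun j hj => by rw [Pi.add_apply, hm₁ j hj, hm₂ j hj, add_zero])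
    rw [map_mul, adHensel_prod_valuation_zpow_add K O n x hx0] at h3
    exact lt_irrefl _ (h3.trans_le (mul_le_mul' h1 h2))
  -- the sub-family of low variables has independent values
  have hsplit : ∀ f : Fin n → ValuationSubring.ValueGroup O,
      (∏ j, f j) = (∏ i : {i : Fin n // lv i < ℓ}, f i.1) * ∏ i : {i : Fin n // ¬ lv i < ℓ}, f i.1 :=
    fun f => (Fintype.prod_subtype_mul_prod_subtype (fun j => lv j < ℓ) f).symm
  have hyi : ∀ m' : {i : Fin n // lv i < ℓ} → ℤ,
      (∏ i, O.valuation (x i.1) ^ (m' i)) = 1 → m' = 0 := by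
    intro m' hm'
    set m : Fin n → ℤ := fun j => if h : lv j < ℓ then m' ⟨j, h⟩ else 0 with hmdef
    have hm : (∏ j, O.valuation (x j) ^ (m j)) = ∏ i : {i : Fin n // lv i < ℓ},
        O.valuation (x i.1) ^ (m' i) := by
      rw [hsplit (fun j => O.valuation (x j) ^ (m j))]
      rw [show (∏ i : {i : Fin n // ¬ lv i < ℓ}, O.valuation (x i.1) ^ (m i.1)) = 1 from
        Finset.prod_eq_one fun i _ => by rw [hmdef]; dsimp only; rw [dif_neg i.2, zpow_zero],
        mul_one]
      exact Finset.prod_congr rfl fun i _ => by rw [hmdef]; dsimp only; rw [dif_pos i.2]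
    have h0 := hxi m (hm.trans hm')
    funext i
    have h1 := congr_fun h0 i.1
    rw [hmdef] at h1
    dsimp only at h1
    rw [dif_pos i.2] at h1
    exact h1
  have hconst : ∀ c : MvPolynomial {i : Fin n // lv i < ℓ} k, small (φ c) → c = 0 := by
    intro c hc
    by_contra hc0
    obtain ⟨μ, -, hμ⟩ := adHensel_exists_dominant O hk (fun i : {i : Fin n // lv i < ℓ} => x i.1)
      (fun i => hx0 i.1) hyi c hc0
    set m : Fin n → ℤ := fun j => if h : lv j < ℓ then (μ ⟨j, h⟩ : ℤ) else 0 with hmdef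
    have hmlow : ∀ j, ℓ ≤ lv j → m j = 0 := fun j hj => by
      rw [hmdef]
      dsimp only
      rw [dif_neg (not_lt.mpr hj)]
    have h := hc m hmlow
    rw [hφdef, hμ, hsplit (fun j => O.valuation (x j) ^ (m j)),
      show (∏ i : {i : Fin n // ¬ lv i < ℓ}, O.valuation (x i.1) ^ (m i.1)) = 1 from
        Finset.prod_eq_one fun i _ => by rw [hmdef]; dsimp only; rw [dif_neg i.2, zpow_zero],
      mul_one] at h
    refine lt_irrefl _ (h.trans_eq (Finset.prod_congr rfl fun i _ => ?_))
    rw [hmdef]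
    dsimp only
    rw [dif_pos i.2, zpow_natCast]
  -- the level-`ℓ` reduction `F_ℓ = π F` of `F`: monic, with small value at `η`
  have hcongr : ∀ G : (MvPolynomial (Fin n) k)[X],
      G.eval₂ (MvPolynomial.aeval x).toRingHom η - G.eval₂ (MvPolynomial.aeval xlo).toRingHom η ∈
        {z | ∃ r : Fin n → K, (∀ i, r i ∈ O) ∧ z = ∑ i, r i * (if lv i < ℓ then 0 else x i)} := by
    intro G
    rw [← eval_map, ← eval_map]
    refine adHensel_eval_sub_eval_mem_sp hη fun i => ?_
    rw [coeff_map, coeff_map]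
    exact adHensel_aeval_sub_aeval_lo_mem_sp x lv ℓ O hk hxO (G.coeff i)
  have hFlo : small (F.eval₂ (MvPolynomial.aeval xlo).toRingHom η) := by
    have h := adHensel_small_of_mem_sp O x hx0 lv ℓ hhi (S := O) (fun _ h => h) (hcongr F)
    rw [hF0, zero_sub] at h
    intro m hm
    rw [← Valuation.map_neg]
    exact h m hm
  have hFls : small ((F.map π.toRingHom).eval₂ φ.toRingHom η) := by
    rw [hev]
    exact hFlo
  have hφO : ∀ g : (MvPolynomial {i : Fin n // lv i < ℓ} k)[X], g.eval₂ φ.toRingHom η ∈ O :=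
    fun g => adHensel_eval₂_mem (y := fun i : {i : Fin n // lv i < ℓ} => x i.1) O hk
      (fun i => hxO i.1) hη g
  obtain ⟨mℓ, cℓ, -, hFmc, hmsmall, hdvd⟩ := adHensel_exists_monic_generator _ K φ.toRingHom η
    small hs0 hsadd (fun g b hb => hsmulO _ _ (hφO g) hb)
    (fun g h hgh => hsprime _ _ (by rw [← eval₂_mul]; exact hgh)) hconst
    (F.map π.toRingHom) (hFm.map _) hFls
  -- reduction to constants: `η̄` is a root of `m̄` and a simple root of `F̄ = m̄ c̄`
  have hεπ : (MvPolynomial.constantCoeff.comp π.toRingHom : MvPolynomial (Fin n) k →+* k) =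
      MvPolynomial.constantCoeff := by
    refine MvPolynomial.ringHom_ext (fun a => ?_) (fun i => ?_)
    · rw [RingHom.comp_apply, MvPolynomial.constantCoeff_C]
      show MvPolynomial.constantCoeff (π (MvPolynomial.C a)) = a
      rw [MvPolynomial.algHom_C, MvPolynomial.algebraMap_eq, MvPolynomial.constantCoeff_C]
    · rw [RingHom.comp_apply, MvPolynomial.constantCoeff_X]
      show MvPolynomial.constantCoeff (π (MvPolynomial.X i)) = 0
      rw [hπdef, MvPolynomial.aeval_X]
      split_ifs
      · exact MvPolynomial.constantCoeff_X _ _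
      · exact map_zero _
  have hfb : F.map MvPolynomial.constantCoeff =
      mℓ.map MvPolynomial.constantCoeff * cℓ.map MvPolynomial.constantCoeff := by
    rw [← Polynomial.map_mul, ← hFmc, Polynomial.map_map, hεπ]
  letI : Algebra k O := algebraOfMem k O hk
  have hres1 : aeval (residue O ⟨η, hη⟩) (derivative (F.map MvPolynomial.constantCoeff)) ≠ 0 :=
    (valuation_aeval_eq_one_iff O hk hη _).mp hfb1
  have hvm : O.valuation (mℓ.eval₂ φ.toRingHom η) < 1 := by
    have h := hmsmall 0 (fun _ _ => rfl)
    simpa only [Pi.zero_apply, zpow_zero, Finset.prod_const_one] using h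
  have hΦ₀ : O.valuation (aeval η (mℓ.map MvPolynomial.constantCoeff)) < 1 := by
    have h1 := adHensel_valuation_eval₂_sub_lt O hk (y := fun i : {i : Fin n // lv i < ℓ} => x i.1)
      (fun i => hxO i.1) (fun i => hvx i.1) hη mℓ
    have e : aeval η (mℓ.map MvPolynomial.constantCoeff) = mℓ.eval₂ φ.toRingHom η -
        (mℓ.eval₂ φ.toRingHom η - aeval η (mℓ.map MvPolynomial.constantCoeff)) := by ring
    rw [e]
    exact lt_of_le_of_lt (Valuation.map_sub _ _ _) (max_lt hvm h1)
  rw [valuation_aeval_lt_one_iff O hk hη] at hΦ₀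
  have hΨ₀ : aeval (residue O ⟨η, hη⟩) (cℓ.map MvPolynomial.constantCoeff) ≠ 0 := by
    intro h0
    apply hres1
    rw [hfb, derivative_mul, map_add, map_mul, map_mul, hΦ₀, h0, zero_mul, mul_zero, add_zero]
  rw [← valuation_aeval_eq_one_iff O hk hη] at hΨ₀
  have hvc : O.valuation (cℓ.eval₂ φ.toRingHom η) = 1 := by
    refine valuation_eq_one_of_sub_lt O ?_ hΨ₀ ((O.valuation_le_one_iff _).mpr (hφO cℓ))
    rw [Valuation.map_sub_swap]
    exact adHensel_valuation_eval₂_sub_lt O hk (y := fun i : {i : Fin n // lv i < ℓ} => x i.1)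
      (fun i => hxO i.1) (fun i => hvx i.1) hη cℓ
  -- the cofactor value `a = c(x; η)`
  have hadj : ∀ g : (MvPolynomial {i : Fin n // lv i < ℓ} k)[X],
      g.eval₂ φ.toRingHom η ∈ Algebra.adjoin k (Set.range x ∪ {η}) := fun g =>
    adHensel_eval₂_mem (y := fun i : {i : Fin n // lv i < ℓ} => x i.1)
      (Algebra.adjoin k (Set.range x ∪ {η})) (fun c => Subalgebra.algebraMap_mem _ c)
      (fun i => Algebra.subset_adjoin (Or.inl ⟨i.1, rfl⟩)) (Algebra.subset_adjoin (Or.inr rfl)) g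
  refine ⟨cℓ.eval₂ φ.toRingHom η, hadj cℓ, hvc, fun G hG => ?_⟩
  have hGl : small ((G.map π.toRingHom).eval₂ φ.toRingHom η) := by
    rw [hev]
    exact hG
  obtain ⟨h, hh⟩ := hdvd _ hGl
  refine ⟨h.eval₂ φ.toRingHom η, hadj h, ?_⟩
  rw [← hev G, ← hev F, hh, hFmc, eval₂_mul, eval₂_mul]
  ring

end Summit.ResolutionOfSingularities.ResolutionOfSingularities.Theorems.PfaffLine
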